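import Summits.CriticalPhenomena.SAWScalingLimit.Theses.SAWPhaseRetrieval
import Literature.Probability.LatticeModels.HexStarDirections
import Literature.Probability.RandomPlanarGeometry.HexParafermionSpinShift

/-!
# Route SAWPhaseRetrieval — `LocalIsotropy` (item stmt-CriticalPhenomena-8317)

LOCAL ISOTROPY (triangle closure at one honeycomb vertex): if `G` satisfies the
Duminil-Copin–Smirnov vertex relation at `v` with neighbours `p, q, r`, the three values are
non-zero and their unit vectors are within `ε ≤ 1/10` of a common unit `w`, then
`| |G(vp)|/|G(vq)| − 1 | ≤ 4ε`.

Proof. The three coefficients `hexMidpoint s(v,x) − hexCenter v = (c x − c v)/2` are `d/2`,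
`ζ²d/2`, `ζ⁴d/2` in one of the two cyclic orders (`hexStar_directions`, `ζ = e^{iπ/3}`), with
`d = c p − c v ≠ 0`; dividing by `d/2` the relation reads `G_p + Ω G_q + Ω̄ G_r = 0` with
`Ω = −1/2 ± i√3/2`.  Multiplying by `conj u_r` (`u_x` the unit vector of `G_x`) makes the last
term real; eliminating it between real and imaginary parts gives the scalar identity
`ρ_p (t·a₁ − a₂) = ρ_q (t·b₁ + b₂)` (`t = ±√3`, `α = conj u_r · u_p = a₁ + i a₂`,
`β = conj u_r · u_q`, unit vectors with `|α − 1|, |β − 1| ≤ 2ε`), and elementary estimates give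
`|ρ_p/ρ_q − 1| ≤ (4ε + 2√3 ε²)/(√3(1 − 2ε²) − 2ε) ≤ 4ε` for `ε ≤ 1/10`.
-/

namespace Summit.CriticalPhenomena.SAWScalingLimit.Theorems

open Literature.Probability.LatticeModels Literature.Probability.RandomPlanarGeometry.SAW
open scoped ComplexConjugate

/-- Scalar core of local isotropy, positive root: for `t = √3`, `0 ≤ ε ≤ 1/10`, `ρ₂ > 0`, unit
vectors `(a₁, a₂)`, `(b₁, b₂)` within `2ε` of `(1, 0)` and `ρ₁ (t a₁ − a₂) = ρ₂ (t b₁ + b₂)`, one has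
`|ρ₁/ρ₂ − 1| ≤ 4ε`. [folklore] -/
theorem localIsotropy_core_pos {t ε ρ₁ ρ₂ a₁ a₂ b₁ b₂ : ℝ} (ht : t ^ 2 = 3) (ht0 : 0 < t)
    (hε0 : 0 ≤ ε) (hε : ε ≤ 1 / 10) (hρ₂ : 0 < ρ₂)
    (ha : a₁ ^ 2 + a₂ ^ 2 = 1) (hb : b₁ ^ 2 + b₂ ^ 2 = 1)
    (ha' : (a₁ - 1) ^ 2 + a₂ ^ 2 ≤ (2 * ε) ^ 2) (hb' : (b₁ - 1) ^ 2 + b₂ ^ 2 ≤ (2 * ε) ^ 2)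
    (hrel : ρ₁ * (t * a₁ - a₂) = ρ₂ * (t * b₁ + b₂)) :
    |ρ₁ / ρ₂ - 1| ≤ 4 * ε := by
  -- elementary bounds on the coordinates
  have ha₁ : 1 - 2 * ε ^ 2 ≤ a₁ := by linarith [ha, ha']
  have hb₁ : 1 - 2 * ε ^ 2 ≤ b₁ := by linarith [hb, hb']
  have ha₁' : a₁ ≤ 1 := by nlinarith [sq_nonneg a₂, sq_nonneg (a₁ + 1)]
  have hb₁' : b₁ ≤ 1 := by nlinarith [sq_nonneg b₂, sq_nonneg (b₁ + 1)]
  have h2ε : (0 : ℝ) ≤ 2 * ε := by positivity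
  have ha₂ : |a₂| ≤ 2 * ε := by
    have h : a₂ ^ 2 ≤ (2 * ε) ^ 2 := by linarith [sq_nonneg (a₁ - 1)]
    exact (sq_le_sq.1 h).trans (abs_of_nonneg h2ε).le
  have hb₂ : |b₂| ≤ 2 * ε := by
    have h : b₂ ^ 2 ≤ (2 * ε) ^ 2 := by linarith [sq_nonneg (b₁ - 1)]
    exact (sq_le_sq.1 h).trans (abs_of_nonneg h2ε).le
  obtain ⟨ha₂l, ha₂u⟩ := abs_le.1 ha₂
  obtain ⟨hb₂l, hb₂u⟩ := abs_le.1 hb₂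
  -- bounds on `t = √3` and on `ε`
  have ht1 : 17 / 10 ≤ t := by nlinarith
  have hε2 : ε ^ 2 ≤ 1 / 100 := by nlinarith
  have htε : t * ε ≤ t * (1 / 10) := mul_le_mul_of_nonneg_left hε ht0.le
  have htε2 : t * ε ^ 2 ≤ t * (1 / 100) := mul_le_mul_of_nonneg_left hε2 ht0.le
  -- the denominator `D = t a₁ - a₂` is bounded below
  have hDlow : t * (1 - 2 * ε ^ 2) - 2 * ε ≤ t * a₁ - a₂ := by
    linarith [mul_le_mul_of_nonneg_left ha₁ ht0.le]
  have hD : 0 < t * a₁ - a₂ := by linarith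
  -- the key scalar inequality `2tε² + 4ε ≤ 4ε D`
  have hbr : 0 ≤ 4 * t - 4 - 2 * t * ε - 8 * t * ε ^ 2 - 8 * ε := by linarith
  have hfin : 2 * t * ε ^ 2 + 4 * ε ≤ 4 * ε * (t * a₁ - a₂) := by
    have h1 : 2 * t * ε ^ 2 + 4 * ε ≤ 4 * ε * (t * (1 - 2 * ε ^ 2) - 2 * ε) := by
      linarith [mul_nonneg hε0 hbr]
    have h2 : 4 * ε * (t * (1 - 2 * ε ^ 2) - 2 * ε) ≤ 4 * ε * (t * a₁ - a₂) :=
      mul_le_mul_of_nonneg_left hDlow (by positivity)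
    linarith
  -- numerator minus denominator, both ways
  have hkey1 : (t * b₁ + b₂) - (t * a₁ - a₂) ≤ 4 * ε * (t * a₁ - a₂) := by
    have : t * (b₁ - a₁) ≤ t * (2 * ε ^ 2) :=
      mul_le_mul_of_nonneg_left (by linarith) ht0.le
    linarith
  have hkey2 : (t * a₁ - a₂) - (t * b₁ + b₂) ≤ 4 * ε * (t * a₁ - a₂) := by
    have : t * (a₁ - b₁) ≤ t * (2 * ε ^ 2) :=
      mul_le_mul_of_nonneg_left (by linarith) ht0.le
    linarith
  -- transfer to `ρ₁`, `ρ₂` through `ρ₁ D = ρ₂ N`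
  have h1 : ρ₁ - ρ₂ ≤ 4 * ε * ρ₂ := by
    by_contra hcon
    linarith [mul_lt_mul_of_pos_right (not_le.1 hcon) hD,
      mul_le_mul_of_nonneg_left hkey1 hρ₂.le]
  have h2 : ρ₂ - ρ₁ ≤ 4 * ε * ρ₂ := by
    by_contra hcon
    linarith [mul_lt_mul_of_pos_right (not_le.1 hcon) hD,
      mul_le_mul_of_nonneg_left hkey2 hρ₂.le]
  rw [div_sub_one hρ₂.ne', abs_div, abs_of_pos hρ₂, div_le_iff₀ hρ₂]
  exact abs_le.2 ⟨by linarith, by linarith⟩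

/-- Scalar core of local isotropy for either root `t = ±√3` (the sign is absorbed by
`a₂ ↦ −a₂`, `b₂ ↦ −b₂`). [folklore] -/
theorem localIsotropy_core {t ε ρ₁ ρ₂ a₁ a₂ b₁ b₂ : ℝ} (ht : t ^ 2 = 3)
    (hε0 : 0 ≤ ε) (hε : ε ≤ 1 / 10) (hρ₂ : 0 < ρ₂)
    (ha : a₁ ^ 2 + a₂ ^ 2 = 1) (hb : b₁ ^ 2 + b₂ ^ 2 = 1)
    (ha' : (a₁ - 1) ^ 2 + a₂ ^ 2 ≤ (2 * ε) ^ 2) (hb' : (b₁ - 1) ^ 2 + b₂ ^ 2 ≤ (2 * ε) ^ 2)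
    (hrel : ρ₁ * (t * a₁ - a₂) = ρ₂ * (t * b₁ + b₂)) :
    |ρ₁ / ρ₂ - 1| ≤ 4 * ε := by
  have ht0 : t ≠ 0 := by rintro rfl; norm_num at ht
  rcases lt_or_gt_of_ne ht0 with hneg | hpos
  · -- `t < 0`: apply the positive case to `-t`, `-a₂`, `-b₂`
    refine localIsotropy_core_pos (t := -t) (a₂ := -a₂) (b₂ := -b₂) (by simpa using ht)
      (by linarith) hε0 hε hρ₂ (by simpa using ha) (by simpa using hb) (by simpa using ha')
      (by simpa using hb') ?_
    linear_combination -hrel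
  · exact localIsotropy_core_pos ht hpos hε0 hε hρ₂ ha hb ha' hb' hrel

/-- Complex bookkeeping for local isotropy: if `G_p + Ω G_q + Ω̄ G_r = 0` with
`Ω = −1/2 + iσ`, `σ² = 3/4`, and the unit vectors of the three non-zero values are within
`ε ≤ 1/10` of a common `w` (its modulus is not needed), then `| |G_p|/|G_q| − 1 | ≤ 4ε`.
[folklore] -/
theorem localIsotropy_cplx {Gp Gq Gr w : ℂ} {σ ε : ℝ} (hσ : σ ^ 2 = 3 / 4)
    (hε0 : 0 ≤ ε) (hε : ε ≤ 1 / 10)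
    (hrel : Gp + ⟨-1 / 2, σ⟩ * Gq + ⟨-1 / 2, -σ⟩ * Gr = 0)
    (hp : Gp ≠ 0) (hq : Gq ≠ 0) (hr : Gr ≠ 0)
    (hpw : ‖Gp / (‖Gp‖ : ℂ) - w‖ ≤ ε) (hqw : ‖Gq / (‖Gq‖ : ℂ) - w‖ ≤ ε)
    (hrw : ‖Gr / (‖Gr‖ : ℂ) - w‖ ≤ ε) :
    |‖Gp‖ / ‖Gq‖ - 1| ≤ 4 * ε := by
  have hρp : 0 < ‖Gp‖ := norm_pos_iff.2 hp
  have hρq : 0 < ‖Gq‖ := norm_pos_iff.2 hq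
  have hρr : 0 < ‖Gr‖ := norm_pos_iff.2 hr
  have hρp' : (‖Gp‖ : ℂ) ≠ 0 := by exact_mod_cast hρp.ne'
  have hρq' : (‖Gq‖ : ℂ) ≠ 0 := by exact_mod_cast hρq.ne'
  have hρr' : (‖Gr‖ : ℂ) ≠ 0 := by exact_mod_cast hρr.ne'
  -- unit vectors (kept as explicit quotients)
  have nup : ‖Gp / (‖Gp‖ : ℂ)‖ = 1 := by
    rw [norm_div, Complex.norm_of_nonneg hρp.le, div_self hρp.ne']
  have nuq : ‖Gq / (‖Gq‖ : ℂ)‖ = 1 := by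
    rw [norm_div, Complex.norm_of_nonneg hρq.le, div_self hρq.ne']
  have nur : ‖Gr / (‖Gr‖ : ℂ)‖ = 1 := by
    rw [norm_div, Complex.norm_of_nonneg hρr.le, div_self hρr.ne']
  have hurur : conj (Gr / (‖Gr‖ : ℂ)) * (Gr / (‖Gr‖ : ℂ)) = 1 := by
    rw [Complex.conj_mul', nur]; simp
  -- the rotated unit vectors `α = conj u_r · u_p`, `β = conj u_r · u_q`
  obtain ⟨α, hα⟩ : ∃ α : ℂ, α = conj (Gr / (‖Gr‖ : ℂ)) * (Gp / (‖Gp‖ : ℂ)) := ⟨_, rfl⟩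
  obtain ⟨β, hβ⟩ : ∃ β : ℂ, β = conj (Gr / (‖Gr‖ : ℂ)) * (Gq / (‖Gq‖ : ℂ)) := ⟨_, rfl⟩
  have nα : ‖α‖ = 1 := by rw [hα, norm_mul, Complex.norm_conj, nur, nup, one_mul]
  have nβ : ‖β‖ = 1 := by rw [hβ, norm_mul, Complex.norm_conj, nur, nuq, one_mul]
  have dα : ‖α - 1‖ ≤ 2 * ε := by
    have : α - 1 = conj (Gr / (‖Gr‖ : ℂ)) * (Gp / (‖Gp‖ : ℂ) - Gr / (‖Gr‖ : ℂ)) := by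
      rw [mul_sub, hurur, hα]
    rw [this, norm_mul, Complex.norm_conj, nur, one_mul]
    calc ‖Gp / (‖Gp‖ : ℂ) - Gr / (‖Gr‖ : ℂ)‖
        ≤ ‖Gp / (‖Gp‖ : ℂ) - w‖ + ‖Gr / (‖Gr‖ : ℂ) - w‖ := by
          rw [← norm_sub_rev w (Gr / (‖Gr‖ : ℂ))]
          exact norm_sub_le_norm_sub_add_norm_sub _ _ _
      _ ≤ ε + ε := add_le_add hpw hrw
      _ = 2 * ε := by ring
  have dβ : ‖β - 1‖ ≤ 2 * ε := by
    have : β - 1 = conj (Gr / (‖Gr‖ : ℂ)) * (Gq / (‖Gq‖ : ℂ) - Gr / (‖Gr‖ : ℂ)) := by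
      rw [mul_sub, hurur, hβ]
    rw [this, norm_mul, Complex.norm_conj, nur, one_mul]
    calc ‖Gq / (‖Gq‖ : ℂ) - Gr / (‖Gr‖ : ℂ)‖
        ≤ ‖Gq / (‖Gq‖ : ℂ) - w‖ + ‖Gr / (‖Gr‖ : ℂ) - w‖ := by
          rw [← norm_sub_rev w (Gr / (‖Gr‖ : ℂ))]
          exact norm_sub_le_norm_sub_add_norm_sub _ _ _
      _ ≤ ε + ε := add_le_add hqw hrw
      _ = 2 * ε := by ring
  -- real coordinates
  have ha : α.re ^ 2 + α.im ^ 2 = 1 := by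
    have h := Complex.sq_norm α
    rw [nα, Complex.normSq_apply] at h
    nlinarith [h]
  have hb : β.re ^ 2 + β.im ^ 2 = 1 := by
    have h := Complex.sq_norm β
    rw [nβ, Complex.normSq_apply] at h
    nlinarith [h]
  have ha' : (α.re - 1) ^ 2 + α.im ^ 2 ≤ (2 * ε) ^ 2 := by
    have h : ‖α - 1‖ ^ 2 ≤ (2 * ε) ^ 2 := pow_le_pow_left₀ (norm_nonneg _) dα 2
    rw [Complex.sq_norm, Complex.normSq_apply] at h
    simpa [sq] using h
  have hb' : (β.re - 1) ^ 2 + β.im ^ 2 ≤ (2 * ε) ^ 2 := by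
    have h : ‖β - 1‖ ^ 2 ≤ (2 * ε) ^ 2 := pow_le_pow_left₀ (norm_nonneg _) dβ 2
    rw [Complex.sq_norm, Complex.normSq_apply] at h
    simpa [sq] using h
  -- the relation, multiplied by `conj u_r`
  have e1 : conj (Gr / (‖Gr‖ : ℂ)) * Gp = (‖Gp‖ : ℂ) * α := by
    rw [hα]; field_simp
  have e2 : conj (Gr / (‖Gr‖ : ℂ)) * Gq = (‖Gq‖ : ℂ) * β := by
    rw [hβ]; field_simp
  have e3 : conj (Gr / (‖Gr‖ : ℂ)) * Gr = (‖Gr‖ : ℂ) := by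
    have h : conj (Gr / (‖Gr‖ : ℂ)) * Gr = (‖Gr‖ : ℂ) * (conj (Gr / (‖Gr‖ : ℂ)) * (Gr / (‖Gr‖ : ℂ))) := by
      field_simp
    rw [h, hurur, mul_one]
  have hE : (‖Gp‖ : ℂ) * α + ⟨-1 / 2, σ⟩ * ((‖Gq‖ : ℂ) * β) + ⟨-1 / 2, -σ⟩ * (‖Gr‖ : ℂ) = 0 := by
    linear_combination conj (Gr / (‖Gr‖ : ℂ)) * hrel - e1 - (⟨-1 / 2, σ⟩ : ℂ) * e2
      - (⟨-1 / 2, -σ⟩ : ℂ) * e3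
  have hre := congrArg Complex.re hE
  have him := congrArg Complex.im hE
  simp only [Complex.add_re, Complex.mul_re, Complex.ofReal_re, Complex.ofReal_im,
    Complex.add_im, Complex.mul_im, Complex.zero_re, Complex.zero_im, zero_mul, sub_zero,
    add_zero, mul_zero, zero_add] at hre him
  have hcore : ‖Gp‖ * ((2 * σ) * α.re - α.im) = ‖Gq‖ * ((2 * σ) * β.re + β.im) := by
    linear_combination 2 * σ * hre - him + 2 * ‖Gq‖ * β.im * hσ
  have ht : (2 * σ) ^ 2 = 3 := by linear_combination 4 * hσ
  exact localIsotropy_core ht hε0 hε hρq ha hb ha' hb' hcore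

/-- `ζ² = e^{2πi/3} = −1/2 + i√3/2`. [folklore] -/
theorem triZeta_sq_eq_mk : triZeta ^ 2 = ⟨-1 / 2, Real.sqrt 3 / 2⟩ := by
  rw [triZeta_sq, triZeta_eq]
  exact Complex.ext (by norm_num) (by norm_num)

/-- `ζ⁴ = e^{4πi/3} = −1/2 − i√3/2`. [folklore] -/
theorem triZeta_pow_four_eq_mk : triZeta ^ 4 = ⟨-1 / 2, -(Real.sqrt 3 / 2)⟩ := by
  have h : triZeta ^ 4 = -triZeta := by
    linear_combination (triZeta ^ 2 + triZeta) * triZeta_sq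
  rw [h, triZeta_eq]
  exact Complex.ext (by norm_num) (by norm_num)

/-- **Local isotropy** (route SAWPhaseRetrieval, item stmt-CriticalPhenomena-8317): at a honeycomb
vertex `v` with neighbours `p, q, r`, if `G` satisfies the Duminil-Copin–Smirnov vertex relation at
`v`, the three values are non-zero and their unit vectors are within `ε ≤ 1/10` of a common unit
`w`, then `| |G(vp)|/|G(vq)| − 1 | ≤ 4ε`. [cite: DuminilCopinSmirnov2012, Lemma 1 (the vertex relation)] -/
theorem localIsotropy_proof :
    Summit.CriticalPhenomena.SAWScalingLimit.Theses.SAWPhaseRetrieval.LocalIsotropy := by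
  intro v p q r G w ε hvp hvq hvr hpq hqr hpr _hw hε0 hε hrel hp hq hr hpw hqw hrw
  have hd : hexCenter p - hexCenter v ≠ 0 := sub_ne_zero.2 (hexCenter_ne_of_adj hvp).symm
  have hmid : ∀ x : HexVertex,
      hexMidpoint s(v, x) - hexCenter v = (hexCenter x - hexCenter v) / 2 := by
    intro x; rw [hexMidpoint_mk]; ring
  rw [hmid p, hmid q, hmid r] at hrel
  have h3 : (Real.sqrt 3 / 2) ^ 2 = 3 / 4 := by
    rw [div_pow, Real.sq_sqrt (by norm_num)]; norm_num
  rcases hexStar_directions hvp hvq hvr hpq hqr hpr with ⟨hq', hr'⟩ | ⟨hq', hr'⟩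
  · rw [hq', hr'] at hrel
    have key : (hexCenter p - hexCenter v) / 2 *
        (G s(v, p) + triZeta ^ 2 * G s(v, q) + triZeta ^ 4 * G s(v, r)) = 0 := by
      rw [← hrel]; ring
    rcases mul_eq_zero.1 key with h | h
    · exact absurd h (div_ne_zero hd two_ne_zero)
    rw [triZeta_sq_eq_mk, triZeta_pow_four_eq_mk] at h
    exact localIsotropy_cplx h3 hε0 hε h hp hq hr hpw hqw hrw
  · rw [hq', hr'] at hrel
    have key : (hexCenter p - hexCenter v) / 2 *
        (G s(v, p) + triZeta ^ 4 * G s(v, q) + triZeta ^ 2 * G s(v, r)) = 0 := by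
      rw [← hrel]; ring
    rcases mul_eq_zero.1 key with h | h
    · exact absurd h (div_ne_zero hd two_ne_zero)
    rw [triZeta_sq_eq_mk, triZeta_pow_four_eq_mk] at h
    have h3' : (-(Real.sqrt 3 / 2)) ^ 2 = 3 / 4 := by rw [neg_sq, h3]
    refine localIsotropy_cplx h3' hε0 hε ?_ hp hq hr hpw hqw hrw
    simpa only [neg_neg] using h

end Summit.CriticalPhenomena.SAWScalingLimit.Theorems
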